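import Literature.Computability.Cryptography.ShorDiscreteLogPostModel
import Literature.Computability.Cryptography.ShorPerfectPowerFP
import Literature.Computability.Complexity.PlumbingBricks
import Literature.Computability.Complexity.HashBricks
import Literature.Computability.Complexity.FPStringBricks
import Literature.Computability.Complexity.StackBricksStrings
import HarnessLib

/-!
# The post-processor of Shor's discrete-logarithm algorithm is polynomial time
(`dlogPost_mem_FP` discharged)

Family `PQC` (trunk `CryptoQuantFine`); companion of `ShorDiscreteLogQuantum.lean` (the named
programming fact `dlogPost_mem_FP`: the classical post-processor `dlogPost` of Kitaev's
discrete-logarithm experiment is polynomial time — Kitaev 1995, §3 Lemma 10 "by a polynomial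
algorithm", §4 p. 15 "processed in a classical way") and of `ShorDiscreteLogPostModel.lean` (its
closed form `dlogPost_eq` in integer arithmetic). This file writes that closed form in the brick
algebra of `FP` string functions (`BrickAlgebra.lean`: records, projections, `fanoutFn`, `iteFn`,
clocked loops `iterate_mem_FP`/`iterate_mem_FP_of_growth`; arithmetic leaves `addFn`, `subFn`,
`prodFn`, `divFn`, `remFn`, `ltFn`, `popCountFn`, `takeFn`, `dropFn`):

* **block tests** (`segRound`, `segLoopF`): for one generator-trial `u < 8` the `ℓ + 1` levels
  are read in order, two windows of `B = 12288 (ℓ+1)` control bits each (cosine, sine), and the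
  test bits `[2 · #ones ≤ B]` are *prepended*, so that the segment comes out top level first —
  the order in which Kitaev's refinement consumes it;
* **refinement** (`refRound`, `refLoopF`): `ℓ` halving steps of `OFPostCF.refineNat` on numerals
  (`a`, the power `P = 2^{d+1}`), reading the quadrant numerator `kq ∈ {1, 3, 5, 7}` off the two
  front bits of the segment;
* **rounding** (`resF`): `((2 a M + 4P) / 8P) mod M` (`dlRes`);
* **congruence solving** (`xgRound`, `xgLoopF`, `solveStepF`, `foldF`): extended Euclid with
  Bézout coefficients reduced modulo `M` (`xgStep`, `2ℓ + 2` rounds) and the four-step fold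
  `solveStepM` from `(M, 0)`;
* `dlogPostF`, `dlogPostF_mem_FP`, **`dlogPostF_eq_dlogPost`** (agreement with `dlogPost_eq` on
  every input) and **`dlogPost_mem_FP_holds : dlogPost_mem_FP`**.

## References

* A. Yu. Kitaev, *Quantum measurements and the Abelian Stabilizer Problem*,
  arXiv:quant-ph/9511026 (1995), §3 Lemma 10, §4 p. 15.
* P. W. Shor, *Polynomial-time algorithms for prime factorization and discrete logarithms on a
  quantum computer*, SIAM J. Comput. 26 (1997) 1484–1509, §6.
* D. E. Knuth, *The Art of Computer Programming*, Vol. 2, 3rd ed. 1998, §4.5.2 Algorithm X.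
* S. Arora, B. Barak, *Computational Complexity: A Modern Approach*, CUP 2009, §1.3 (closure of
  polynomial time under composition and bounded loops).
-/

noncomputable section

namespace Literature.Computability.Cryptography

namespace Kitaev1995

namespace DLogPostFP

open _root_.Computability Polynomial Complexity Complexity.Brick Complexity.Plumb
  Complexity.HashBricks Complexity.PRelSigma ShorFP OFPostCF

/-! ### Numerals: small facts -/

/-- `encodeNat n = [] ↔ n = 0` (twin of `TavRecode.encodeNat_eq_nil_iff`, `AlgebraicComplexity/`, restated to keep
the import closure of this file inside `Complexity/` + `Cryptography/`). [folklore] -/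
theorem encodeNat_eq_nil_iff (n : ℕ) : encodeNat n = [] ↔ n = 0 := by
  constructor
  · intro h
    have := congrArg bitsToNat h
    simpa using this
  · rintro rfl; rfl

/-! ### The block tests of one generator-trial -/

/-- The block length as a polynomial of the instance length: `B(ℓ) = 12288 (ℓ + 1) = dlBlockSize ℓ`.
(Kept behind `Polynomial.eval`, so that no kernel reduction ever meets the literal.) [folklore] -/
def bwPoly : Polynomial ℕ := C 12288 * (X + 1)

/-- `bwPoly` evaluates to `dlBlockSize`. [folklore] -/
theorem bwPoly_eval (n : ℕ) : bwPoly.eval n = dlBlockSize n := by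
  simp only [bwPoly, eval_mul, eval_C, eval_add, eval_X, eval_one, dlBlockSize, dlNumLevels]

/-- The block-length word `1^B`, `B = dlBlockSize |w|`, from `w` (`Plumb.polyFn`). [folklore] -/
def bwF : List Bool → List Bool := polyFn bwPoly

/-- Length of `bwF`. [folklore] -/
@[simp] theorem length_bwF (w : List Bool) : (bwF w).length = dlBlockSize w.length := by
  rw [bwF, polyFn_apply, List.length_replicate, bwPoly_eval]

/-- `bwF ∈ FP`. [folklore] -/
theorem bwF_mem_FP : bwF ∈ FP := polyFn_mem_FP _

/-- The test bit of a window: `[2 · #{ones among the first B bits} ≤ B]`.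
[cite: Kitaev1995, §3 (before Lemma 9: "count how many 1's")] -/
def tbW (B : ℕ) (r : List Bool) : Bool := decide (2 * (r.take B).count true ≤ B)

/-- The number of ones in the first window of `rest`, on `⟨w, rest⟩`, as a numeral. [folklore] -/
def wcntF : List Bool → List Bool := popCountFn ∘ takeFn ∘ fanoutFn (bwF ∘ fstF) sndF

/-- Value of `wcntF`. [folklore] -/
@[simp] theorem cntF_apply (w rest : List Bool) :
    wcntF (boolPair w rest) = encodeNat ((rest.take (dlBlockSize w.length)).count true) := by
  simp [wcntF]

/-- `wcntF ∈ FP`. [folklore] -/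
theorem cntF_mem_FP : wcntF ∈ FP :=
  comp_mem_FP popCountFn_mem_FP (comp_mem_FP takeFn_mem_FP
    (fanoutFn_mem_FP (comp_mem_FP bwF_mem_FP fstF_mem_FP) sndF_mem_FP))

/-- The test bit of the first window of `rest`, on `⟨w, rest⟩`: `[tbW B rest]`. [folklore] -/
def tbF : List Bool → List Bool :=
  notFn (ltFn ∘ fanoutFn (lenBinF ∘ bwF ∘ fstF) (addFn ∘ fanoutFn wcntF wcntF))

/-- Value of `tbF`. [folklore] -/
@[simp] theorem tbF_apply (w rest : List Bool) :
    tbF (boolPair w rest) = [tbW (dlBlockSize w.length) rest] := by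
  rw [tbF, notFn_apply (b := decide (dlBlockSize w.length < 2 * (rest.take (dlBlockSize w.length)).count true))]
  · simp only [tbW, two_mul]
    generalize dlBlockSize w.length = B
    congr 1
    by_cases h : (rest.take B).count true + (rest.take B).count true ≤ B
    · rw [decide_eq_true h, decide_eq_false (not_lt.2 h)]; rfl
    · rw [decide_eq_false h, decide_eq_true (lt_of_not_ge h)]; rfl
  · simp [two_mul]

/-- `tbF ∈ FP`. [folklore] -/
theorem tbF_mem_FP : tbF ∈ FP :=
  notFn_mem_FP (comp_mem_FP ltFn_mem_FP (fanoutFn_mem_FP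
    (comp_mem_FP lenBinF_mem_FP (comp_mem_FP bwF_mem_FP fstF_mem_FP))
    (comp_mem_FP addFn_mem_FP (fanoutFn_mem_FP cntF_mem_FP cntF_mem_FP))))

/-- `tbF` is one-bit. [folklore] -/
theorem oneBit_tbF : OneBit tbF := oneBit_notFn (oneBit_ltFn.comp _)

/-- The test bit of the *second* window of `rest`, on `⟨w, rest⟩` (the sine test of the level).
[folklore] -/
def sinBitF : List Bool → List Bool := tbF ∘ fanoutFn fstF (dropFn ∘ fanoutFn (bwF ∘ fstF) sndF)

/-- Value of `sinBitF`. [folklore] -/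
@[simp] theorem sinBitF_apply (w rest : List Bool) :
    sinBitF (boolPair w rest) = [tbW (dlBlockSize w.length) (rest.drop (dlBlockSize w.length))] := by
  simp [sinBitF]

/-- `sinBitF ∈ FP`. [folklore] -/
theorem sinBitF_mem_FP : sinBitF ∈ FP :=
  comp_mem_FP tbF_mem_FP (fanoutFn_mem_FP fstF_mem_FP
    (comp_mem_FP dropFn_mem_FP (fanoutFn_mem_FP (comp_mem_FP bwF_mem_FP fstF_mem_FP) sndF_mem_FP)))

/-- The two new test bits of one level, on `⟨w, rest⟩`: sine window (the second) first, then
the cosine window. [folklore] -/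
def twoBitsF : List Bool → List Bool := fun z => sinBitF z ++ tbF z

/-- Value of `twoBitsF`. [folklore] -/
@[simp] theorem twoBitsF_apply (w rest : List Bool) :
    twoBitsF (boolPair w rest) =
      [tbW (dlBlockSize w.length) (rest.drop (dlBlockSize w.length)), tbW (dlBlockSize w.length) rest] := by
  simp [twoBitsF]

/-- `twoBitsF ∈ FP`. [folklore] -/
theorem twoBitsF_mem_FP : twoBitsF ∈ FP := append_mem_FP sinBitF_mem_FP tbF_mem_FP

/-- `|twoBitsF z| = 2`. [folklore] -/
theorem length_twoBitsF (z : List Bool) : (twoBitsF z).length = 2 := by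
  obtain ⟨b, hb⟩ := oneBit_tbF (fanoutFn fstF (dropFn ∘ fanoutFn (bwF ∘ fstF) sndF) z)
  obtain ⟨b', hb'⟩ := oneBit_tbF z
  rw [twoBitsF, sinBitF, Function.comp_apply, hb, hb']; rfl

/-- **One round of the block tests** on `⟨w, ⟨rest, seg⟩⟩`: drop two windows of `rest`, prepend
their test bits to `seg`. [cite: Kitaev1995, §3 (before Lemma 9)] -/
def segRound : List Bool → List Bool :=
  fanoutFn fstF (fanoutFn
    (dropFn ∘ fanoutFn (bwF ∘ fstF) (dropFn ∘ fanoutFn (bwF ∘ fstF) (nthF 1)))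
    (fun z => twoBitsF (fanoutFn fstF (nthF 1) z) ++ sndPow 1 z))

/-- Value of `segRound`. [folklore] -/
theorem segRound_apply (w rest seg : List Bool) :
    segRound (boolPair w (boolPair rest seg)) =
      boolPair w (boolPair (rest.drop (dlBlockSize w.length + dlBlockSize w.length))
        ([tbW (dlBlockSize w.length) (rest.drop (dlBlockSize w.length)), tbW (dlBlockSize w.length) rest] ++ seg)) := by
  simp [segRound]

/-- `segRound ∈ FP`. [folklore] -/
theorem segRound_mem_FP : segRound ∈ FP :=
  fanoutFn_mem_FP fstF_mem_FP (fanoutFn_mem_FP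
    (comp_mem_FP dropFn_mem_FP (fanoutFn_mem_FP (comp_mem_FP bwF_mem_FP fstF_mem_FP)
      (comp_mem_FP dropFn_mem_FP (fanoutFn_mem_FP (comp_mem_FP bwF_mem_FP fstF_mem_FP) (nthF_mem_FP 1)))))
    (append_mem_FP (comp_mem_FP twoBitsF_mem_FP (fanoutFn_mem_FP fstF_mem_FP (nthF_mem_FP 1))) (sndPow_mem_FP 1)))

/-- `segRound` lengthens no input by more than `8`. [folklore] -/
theorem length_segRound_le (z : List Bool) : (segRound z).length ≤ z.length + 8 := by
  rw [segRound, fanoutFn_apply, fanoutFn_apply, length_boolPair, length_boolPair, List.length_append,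
    length_twoBitsF]
  have h0 := length_fstF_sndF_le z
  have h1 := length_nthF_succ_add_sndPow_succ_le 0 z
  simp only [Nat.zero_add, sndPow_zero] at h1
  have h2 : ((dropFn ∘ fanoutFn (bwF ∘ fstF) (dropFn ∘ fanoutFn (bwF ∘ fstF) (nthF 1))) z).length ≤ (nthF 1 z).length := by
    simp
  omega

/-- The model of the block tests with window length `B`: `k` levels from `rest`, prepended to
`seg`. [folklore] -/
def segModel (B : ℕ) : ℕ → List Bool → List Bool → List Bool
  | 0, _, seg => seg
  | k + 1, rest, seg => segModel B k (rest.drop (B + B)) ([tbW B (rest.drop B), tbW B rest] ++ seg)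

/-- Rounds of the block tests follow the model. [folklore] -/
theorem iterate_segRound (w : List Bool) : ∀ (k : ℕ) (rest seg : List Bool),
    segRound^[k] (boolPair w (boolPair rest seg)) =
      boolPair w (boolPair (rest.drop ((dlBlockSize w.length + dlBlockSize w.length) * k))
        (segModel (dlBlockSize w.length) k rest seg))
  | 0, rest, seg => by simp [segModel]
  | k + 1, rest, seg => by
    rw [Function.iterate_succ_apply, segRound_apply, iterate_segRound w k, segModel, List.drop_drop, Nat.mul_succ,
      Nat.add_comm]

/-- The reversed segment as a list of level pairs: `f (n-1) ++ … ++ f 0`. [folklore] -/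
def revPairs (f : ℕ → List Bool) : ℕ → List Bool
  | 0 => []
  | n + 1 => f n ++ revPairs f n

/-- The pair of test bits of level `l` read at offset `2 l B` of `rest`: sine bit (window
`2l + 1`), cosine bit (window `2l`). [folklore] -/
def lvBits (B : ℕ) (rest : List Bool) (l : ℕ) : List Bool :=
  [tbW B (rest.drop ((B + B) * l + B)), tbW B (rest.drop ((B + B) * l))]

/-- `revPairs f 0 = []`. [folklore] -/
@[simp] theorem revPairs_zero (f : ℕ → List Bool) : revPairs f 0 = [] := rfl

/-- `revPairs f (n+1) = f n ++ revPairs f n`. [folklore] -/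
theorem revPairs_succ (f : ℕ → List Bool) (n : ℕ) : revPairs f (n + 1) = f n ++ revPairs f n := rfl

/-- **The model is the reversed segment**: started on `revPairs (lvBits B rest₀) j` with
`rest = rest₀ ⇂ 2jB`, `k` more rounds give `revPairs (lvBits B rest₀) (j + k)`. [folklore] -/
theorem segModel_eq (B : ℕ) (rest₀ : List Bool) : ∀ (k j : ℕ),
    segModel B k (rest₀.drop ((B + B) * j)) (revPairs (lvBits B rest₀) j) = revPairs (lvBits B rest₀) (j + k)
  | 0, j => by simp [segModel]
  | k + 1, j => by
    rw [segModel, List.drop_drop, List.drop_drop, ← Nat.mul_succ,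
      show [tbW B (rest₀.drop ((B + B) * j + B)), tbW B (rest₀.drop ((B + B) * j))] ++ revPairs (lvBits B rest₀) j =
        revPairs (lvBits B rest₀) (j + 1) from rfl,
      segModel_eq B rest₀ k (j + 1), Nat.succ_add_eq_add_succ]

/-- **The block-test loop**: `|w| + 1` rounds of `segRound` from `⟨w, ⟨rest, []⟩⟩`. [folklore] -/
def segLoopF : List Bool → List Bool :=
  (fun z => segRound^[(X + 1 : Polynomial ℕ).eval (boolUnpair z).1.length] z) ∘
    fanoutFn fstF (fanoutFn sndF (fun _ => []))

/-- `segLoopF ∈ FP`. [cite: AroraBarak2009, §1.3 (bounded loops)] -/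
theorem segLoopF_mem_FP : segLoopF ∈ FP :=
  comp_mem_FP (iterate_mem_FP segRound_mem_FP 8 length_segRound_le (X + 1))
    (fanoutFn_mem_FP fstF_mem_FP (fanoutFn_mem_FP sndF_mem_FP (const_mem_FP _)))

/-- The number of control bits of one generator-trial: `2 (ℓ + 1) B`, written as the loop leaves
it. [folklore] -/
def genLen (ℓ : ℕ) : ℕ := (dlBlockSize ℓ + dlBlockSize ℓ) * (ℓ + 1)

/-- **Value of the block-test loop** on `⟨w, rest⟩`: the rest advanced by `2 (ℓ+1) B` and the
reversed segment `revPairs (lvBits B rest) (ℓ + 1)` (`ℓ = |w|`). [folklore] -/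
theorem segLoopF_apply (w rest : List Bool) :
    segLoopF (boolPair w rest) =
      boolPair w (boolPair (rest.drop (genLen w.length))
        (revPairs (lvBits (dlBlockSize w.length) rest) (w.length + 1))) := by
  have h := segModel_eq (dlBlockSize w.length) rest (w.length + 1) 0
  rw [Nat.mul_zero, List.drop_zero, revPairs_zero, Nat.zero_add] at h
  simp only [segLoopF, Function.comp_apply, fanoutFn_apply, fstF_boolPair, sndF_boolPair, boolUnpair_boolPair,
    eval_add, eval_X, eval_one, iterate_segRound, h, genLen]

/-! ### The context record `⟨w, ⟨M, rest⟩⟩` and the eight generator-trials -/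

/-- The canonical numeral of an arbitrary string (`canonBits`, `ShorOrdPost.lean`; twin of
`ShorFP.canonF` of `ShorStepFP.lean`, restated to keep this file's imports independent of that
development). [folklore] -/
def canonF' : List Bool → List Bool :=
  iteFn isNilFn idF (iteFn (parityFn ∘ lastBitF) (fun z => idF z ++ [true]) idF)
where
  /-- the last symbol of a string (or `ε`) -/
  lastBitF : List Bool → List Bool := sndF ∘ padTakeFn ∘ fanoutFn (sndF ∘ padTakeFn ∘ fanoutFn (fun _ => [true]) idF) idF

/-- Value of the last-symbol brick. [folklore] -/
@[simp] theorem lastBitF_apply (z : List Bool) : canonF'.lastBitF z = z.drop (z.length - 1) := by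
  simp [canonF'.lastBitF, idF, padTakeFn]

/-- `canonF'.lastBitF ∈ FP`. [folklore] -/
theorem lastBitF_mem_FP : canonF'.lastBitF ∈ FP :=
  comp_mem_FP sndF_mem_FP (comp_mem_FP padTakeFn_mem_FP (fanoutFn_mem_FP
    (comp_mem_FP sndF_mem_FP (comp_mem_FP padTakeFn_mem_FP (fanoutFn_mem_FP (const_mem_FP _) idF_mem_FP))) idF_mem_FP))

/-- **`canonF' = canonBits`.** [folklore] -/
@[simp] theorem canonF'_apply (z : List Bool) : canonF' z = canonBits z := by
  unfold canonF'
  by_cases hz : z = []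
  · subst hz
    rw [iteFn_apply_true (by simp [isNilFn])]
    simp [idF, canonBits]
  · rw [iteFn_apply_false (by simp [isNilFn, hz])]
    have hlast : canonF'.lastBitF z = [z.getLast hz] := by
      rw [lastBitF_apply, List.drop_length_sub_one hz]
    have hgl : z.getLast? = some (z.getLast hz) := List.getLast?_eq_some_getLast hz
    cases hb : z.getLast hz with
    | false =>
      rw [iteFn_apply_true (by rw [Function.comp_apply, hlast, hb]; simp [parityFn])]
      rw [hb] at hgl
      simp [idF, canonBits, hgl]
    | true =>
      rw [iteFn_apply_false (by rw [Function.comp_apply, hlast, hb]; simp [parityFn])]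
      rw [hb] at hgl
      simp [idF, canonBits, hgl]

/-- `canonF' ∈ FP`. [folklore] -/
theorem canonF'_mem_FP : canonF' ∈ FP :=
  iteFn_mem_FP isNilFn_mem_FP idF_mem_FP
    (iteFn_mem_FP (comp_mem_FP parityFn_mem_FP lastBitF_mem_FP) (append_mem_FP idF_mem_FP (const_mem_FP _)) idF_mem_FP)

/-- The modulus numeral `encodeNat (dlMod w)` from the instance string `w`. [folklore] -/
def modF : List Bool → List Bool := predF ∘ canonF' ∘ fstF

/-- Value of `modF`. [folklore] -/
@[simp] theorem modF_apply (w : List Bool) : modF w = encodeNat (dlMod w) := by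
  simp [modF, dlMod, fstF, bitsToNat_canonBits]

/-- `modF ∈ FP`. [folklore] -/
theorem modF_mem_FP : modF ∈ FP := comp_mem_FP predF_mem_FP (comp_mem_FP canonF'_mem_FP fstF_mem_FP)

/-- The context record `⟨w, ⟨encodeNat M, rest⟩⟩`. [folklore] -/
def ctx (w : List Bool) (M : ℕ) (rest : List Bool) : List Bool := boolPair w (boolPair (encodeNat M) rest)

/-- **The initial context** of an input `z = ⟨w, y⟩`: `⟨w, ⟨encodeNat (dlMod w), y ⇂ |w|⟩⟩` (the
pair is re-assembled from its decoded components, so this holds on *every* string). [folklore] -/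
def ctx0F : List Bool → List Bool := fanoutFn fstF (fanoutFn (modF ∘ fstF) (dropFn ∘ fanoutFn fstF sndF))

/-- Value of `ctx0F`. [folklore] -/
theorem ctx0F_apply (z : List Bool) :
    ctx0F z = ctx (boolUnpair z).1 (dlMod (boolUnpair z).1) ((boolUnpair z).2.drop (boolUnpair z).1.length) := by
  simp [ctx0F, ctx, fstF, sndF]

/-- `ctx0F ∈ FP`. [folklore] -/
theorem ctx0F_mem_FP : ctx0F ∈ FP :=
  fanoutFn_mem_FP fstF_mem_FP (fanoutFn_mem_FP (comp_mem_FP modF_mem_FP fstF_mem_FP)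
    (comp_mem_FP dropFn_mem_FP (fanoutFn_mem_FP fstF_mem_FP sndF_mem_FP)))

/-- **Advancing the context by one generator-trial**: `rest` past its `2 (ℓ+1)` windows.
[folklore] -/
def nextF : List Bool → List Bool :=
  fanoutFn fstF (fanoutFn (nthF 1) (nthF 1 ∘ segLoopF ∘ fanoutFn fstF (sndPow 1)))

/-- Value of `nextF`. [folklore] -/
@[simp] theorem nextF_ctx (w : List Bool) (M : ℕ) (rest : List Bool) :
    nextF (ctx w M rest) = ctx w M (rest.drop (genLen w.length)) := by
  simp only [nextF, ctx, Function.comp_apply, fanoutFn_apply, fstF_boolPair, nthF_succ_boolPair, nthF_zero_boolPair,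
    sndPow_succ_boolPair, sndPow_zero_boolPair, segLoopF_apply]

/-- `nextF ∈ FP`. [folklore] -/
theorem nextF_mem_FP : nextF ∈ FP :=
  fanoutFn_mem_FP fstF_mem_FP (fanoutFn_mem_FP (nthF_mem_FP 1)
    (comp_mem_FP (nthF_mem_FP 1) (comp_mem_FP segLoopF_mem_FP (fanoutFn_mem_FP fstF_mem_FP (sndPow_mem_FP 1)))))

/-- Iterates of `nextF` are in `FP`. [folklore] -/
theorem nextF_iterate_mem_FP : ∀ u : ℕ, (nextF^[u]) ∈ FP
  | 0 => idF_mem_FP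
  | u + 1 => by rw [Function.iterate_succ']; exact comp_mem_FP nextF_mem_FP (nextF_iterate_mem_FP u)

/-- Iterates of `nextF` on a context. [folklore] -/
theorem nextF_iterate_ctx (w : List Bool) (M : ℕ) : ∀ (u : ℕ) (rest : List Bool),
    nextF^[u] (ctx w M rest) = ctx w M (rest.drop (genLen w.length * u))
  | 0, rest => by simp
  | u + 1, rest => by
    rw [Function.iterate_succ_apply, nextF_ctx, nextF_iterate_ctx w M u, List.drop_drop, Nat.mul_succ, Nat.add_comm]

/-- **The reversed segment of the current generator-trial** of a context. [folklore] -/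
def segF : List Bool → List Bool := sndPow 1 ∘ segLoopF ∘ fanoutFn fstF (sndPow 1)

/-- Value of `segF`. [folklore] -/
@[simp] theorem segF_ctx (w : List Bool) (M : ℕ) (rest : List Bool) :
    segF (ctx w M rest) = revPairs (lvBits (dlBlockSize w.length) rest) (w.length + 1) := by
  simp only [segF, ctx, Function.comp_apply, fanoutFn_apply, fstF_boolPair, sndPow_succ_boolPair,
    sndPow_zero_boolPair, segLoopF_apply]

/-- `segF ∈ FP`. [folklore] -/
theorem segF_mem_FP : segF ∈ FP :=
  comp_mem_FP (sndPow_mem_FP 1) (comp_mem_FP segLoopF_mem_FP (fanoutFn_mem_FP fstF_mem_FP (sndPow_mem_FP 1)))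

/-! ### Kitaev's refinement on numerals -/

/-- The quadrant numerator read off the two front bits of a reversed segment (sine bit first,
cosine bit second): `kq cos sin ∈ {1, 3, 5, 7}`. [cite: Kitaev1995, §3 Lemma 10] -/
def kqv (seg : List Bool) : ℕ := kq (seg.tail.headD false) (seg.headD false)

/-- `kqv` of a segment starting with the level pair `[s, c]`. [folklore] -/
@[simp] theorem kqv_cons_cons (s c : Bool) (seg : List Bool) : kqv (s :: c :: seg) = kq c s := rfl

/-- `kqv < 8`. [folklore] -/
theorem kqv_lt (seg : List Bool) : kqv seg < 8 := kq_lt _ _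

/-- The quadrant numerator as a numeral, from the segment. [folklore] -/
def kqF : List Bool → List Bool :=
  iteFn (headBitFn ∘ List.tail) (iteFn headBitFn (fun _ => encodeNat 1) (fun _ => encodeNat 7))
    (iteFn headBitFn (fun _ => encodeNat 3) (fun _ => encodeNat 5))

/-- Value of `kqF`. [folklore] -/
@[simp] theorem kqF_apply (seg : List Bool) : kqF seg = encodeNat (kqv seg) := by
  unfold kqF kqv kq
  cases hc : seg.tail.headD false
  · rw [iteFn_apply_false (by rw [Function.comp_apply, headBitFn_apply, hc])]
    cases hs : seg.headD false
    · rw [iteFn_apply_false (by rw [headBitFn_apply, hs])]; rfl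
    · rw [iteFn_apply_true (by rw [headBitFn_apply, hs])]; rfl
  · rw [iteFn_apply_true (by rw [Function.comp_apply, headBitFn_apply, hc])]
    cases hs : seg.headD false
    · rw [iteFn_apply_false (by rw [headBitFn_apply, hs])]; rfl
    · rw [iteFn_apply_true (by rw [headBitFn_apply, hs])]; rfl

/-- `kqF ∈ FP`. [folklore] -/
theorem kqF_mem_FP : kqF ∈ FP :=
  iteFn_mem_FP (comp_mem_FP headBitFn_mem_FP tail_mem_FP)
    (iteFn_mem_FP headBitFn_mem_FP (const_mem_FP _) (const_mem_FP _))
    (iteFn_mem_FP headBitFn_mem_FP (const_mem_FP _) (const_mem_FP _))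

/-- **One step of the refinement** (Kitaev 1995, §3 Lemma 10: of the two halves of the current
estimate keep the one closer, on the circle, to the next level's quadrant centre), on numerators
over `8P`, `P = 2^{d+1}`: with `N = 8P`, `v = κ P`, replace `a` by `a + 4P` iff
`md ((a + 4P + N − v) mod N) N < md ((a + N − v) mod N) N`. [cite: Kitaev1995, §3 Lemma 10] -/
def refStep (κ a P : ℕ) : ℕ :=
  if md ((a + 4 * P + 8 * P - κ * P) % (8 * P)) (8 * P) < md ((a + 8 * P - κ * P) % (8 * P)) (8 * P)
  then a + 4 * P else a

/-- **`refStep` is the step of `OFPostCF.refineNat`.** [cite: Kitaev1995, §3 Lemma 10] -/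
theorem refineNat_succ_eq_refStep (κ : ℕ → ℕ) (L d : ℕ) :
    refineNat κ L (d + 1) = refStep (κ (L - 1 - (d + 1))) (refineNat κ L d) (2 ^ (d + 1)) := by
  have hN : 8 * 2 ^ (d + 1) / 2 = 4 * 2 ^ (d + 1) := by omega
  simp only [refineNat, refStep, hN]
  split_ifs <;> omega

/-- `refStep κ a P ≤ a + 4P`. [folklore] -/
theorem refStep_le (κ a P : ℕ) : refStep κ a P ≤ a + 4 * P := by
  unfold refStep; split_ifs <;> omega

/-- `refineNat` only reads `κ` below `L`. [folklore] -/
theorem refineNat_congr {κ κ' : ℕ → ℕ} {L : ℕ} (h : ∀ l, l ≤ L - 1 → κ l = κ' l) :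
    ∀ d, refineNat κ L d = refineNat κ' L d
  | 0 => by simp [refineNat, h (L - 1) le_rfl]
  | d + 1 => by
    rw [refineNat_succ_eq_refStep, refineNat_succ_eq_refStep, refineNat_congr h d, h _ (Nat.sub_le _ _)]

/-- The refinement record `⟨w, ⟨seg, ⟨a, P⟩⟩⟩`. [folklore] -/
def rrec (w seg aw Pw : List Bool) : List Bool := boolPair w (boolPair seg (boolPair aw Pw))

/-- The truncation width word `1^{|w|+5}` (powers `P ≤ 2^{|w|+1}` pass unchanged; the truncation
only bounds the growth of the loop on ill-formed records). [folklore] -/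
def twF : List Bool → List Bool := polyFn (X + C 5) ∘ fstF

/-- Length of the width word. [folklore] -/
@[simp] theorem length_twF (r : List Bool) : (twF r).length = (fstF r).length + 5 := by
  simp [twF]

/-- `twF ∈ FP`. [folklore] -/
theorem twF_mem_FP : twF ∈ FP := comp_mem_FP (polyFn_mem_FP _) fstF_mem_FP

/-- The truncated power `P mod 2^{|w|+5}`, as a numeral (reads the fields `w` and `P`). [folklore] -/
def ptF : List Bool → List Bool := lowBitsFn ∘ fanoutFn twF (sndPow 2)

/-- Value of `ptF` on every record. [folklore] -/
theorem ptF_eq (r : List Bool) : ptF r = encodeNat (bitsToNat (sndPow 2 r) % 2 ^ ((fstF r).length + 5)) := by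
  rw [ptF, Function.comp_apply, fanoutFn_apply, lowBitsFn_boolPair_eq_encodeNat, length_twF]

/-- Value of `ptF` on a refinement record. [folklore] -/
@[simp] theorem ptF_rrec (w seg aw Pw : List Bool) :
    ptF (rrec w seg aw Pw) = encodeNat (bitsToNat Pw % 2 ^ (w.length + 5)) := by
  rw [ptF_eq]; simp [rrec]

/-- `ptF ∈ FP`. [folklore] -/
theorem ptF_mem_FP : ptF ∈ FP := comp_mem_FP lowBitsFn_mem_FP (fanoutFn_mem_FP twF_mem_FP (sndPow_mem_FP 2))

/-- The truncated power is below `2^{|w|+5}`. [folklore] -/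
theorem bitsToNat_ptF_lt (r : List Bool) : bitsToNat (ptF r) < 2 ^ ((fstF r).length + 5) := by
  rw [ptF_eq, bitsToNat_encodeNat]; exact Nat.mod_lt _ (by positivity)

/-- A numeral multiple `c · ⟦f⟧`. [folklore] -/
def mulCF (c : ℕ) (f : List Bool → List Bool) : List Bool → List Bool := prodFn ∘ fanoutFn (fun _ => encodeNat c) f

/-- Value of `mulCF`. [folklore] -/
@[simp] theorem mulCF_apply (c : ℕ) (f : List Bool → List Bool) (z : List Bool) :
    mulCF c f z = encodeNat (c * bitsToNat (f z)) := by
  simp [mulCF]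

/-- `mulCF c f ∈ FP`. [folklore] -/
theorem mulCF_mem_FP (c : ℕ) {f : List Bool → List Bool} (hf : f ∈ FP) : mulCF c f ∈ FP :=
  comp_mem_FP prodFn_mem_FP (fanoutFn_mem_FP (const_mem_FP _) hf)

/-- `N = 8 P` (truncated `P`). [folklore] -/
def nF : List Bool → List Bool := mulCF 8 ptF
/-- `H = 4 P`. [folklore] -/
def hF : List Bool → List Bool := mulCF 4 ptF
/-- `v = κ P`. [folklore] -/
def vF : List Bool → List Bool := prodFn ∘ fanoutFn (kqF ∘ nthF 1) ptF
/-- `(a + N - v) mod N`. [folklore] -/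
def a1F : List Bool → List Bool := remFn ∘ fanoutFn (subFn ∘ fanoutFn (addFn ∘ fanoutFn (nthF 2) nF) vF) nF
/-- `(a + H + N - v) mod N`. [folklore] -/
def a2F : List Bool → List Bool :=
  remFn ∘ fanoutFn (subFn ∘ fanoutFn (addFn ∘ fanoutFn (addFn ∘ fanoutFn (nthF 2) hF) nF) vF) nF
/-- The smaller of two numerals. [folklore] -/
def minF : List Bool → List Bool := iteFn ltFn fstF sndF
/-- `md x N = min x (N - x)` of a field `x`. [folklore] -/
def mdF (x : List Bool → List Bool) : List Bool → List Bool := minF ∘ fanoutFn x (subFn ∘ fanoutFn nF x)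
/-- The comparison `md a2 < md a1`. [folklore] -/
def condF : List Bool → List Bool := ltFn ∘ fanoutFn (mdF a2F) (mdF a1F)
/-- The new numerator `a' = refStep κ a P`. [folklore] -/
def a'F : List Bool → List Bool := iteFn condF (addFn ∘ fanoutFn (nthF 2) hF) (addFn ∘ fanoutFn (nthF 2) (fun _ => []))
/-- The new power `P' = 2P`. [folklore] -/
def p'F : List Bool → List Bool := addFn ∘ fanoutFn ptF ptF
/-- The rest of the segment. [folklore] -/
def seg'F : List Bool → List Bool := List.tail ∘ List.tail ∘ nthF 1

/-- **One round of the refinement** on `⟨w, ⟨seg, ⟨a, P⟩⟩⟩`. [cite: Kitaev1995, §3 Lemma 10] -/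
def refRound : List Bool → List Bool := fanoutFn fstF (fanoutFn seg'F (fanoutFn a'F p'F))

/-- `nF_mem_FP`: membership in `FP` by composition of bricks. [folklore] -/
theorem nF_mem_FP : nF ∈ FP := mulCF_mem_FP 8 ptF_mem_FP
/-- `hF_mem_FP`: membership in `FP` by composition of bricks. [folklore] -/
theorem hF_mem_FP : hF ∈ FP := mulCF_mem_FP 4 ptF_mem_FP
/-- `vF_mem_FP`: membership in `FP` by composition of bricks. [folklore] -/
theorem vF_mem_FP : vF ∈ FP := comp_mem_FP prodFn_mem_FP (fanoutFn_mem_FP (comp_mem_FP kqF_mem_FP (nthF_mem_FP 1)) ptF_mem_FP)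
/-- `a1F_mem_FP`: membership in `FP` by composition of bricks. [folklore] -/
theorem a1F_mem_FP : a1F ∈ FP :=
  comp_mem_FP remFn_mem_FP (fanoutFn_mem_FP (comp_mem_FP subFn_mem_FP (fanoutFn_mem_FP
    (comp_mem_FP addFn_mem_FP (fanoutFn_mem_FP (nthF_mem_FP 2) nF_mem_FP)) vF_mem_FP)) nF_mem_FP)
/-- `a2F_mem_FP`: membership in `FP` by composition of bricks. [folklore] -/
theorem a2F_mem_FP : a2F ∈ FP :=
  comp_mem_FP remFn_mem_FP (fanoutFn_mem_FP (comp_mem_FP subFn_mem_FP (fanoutFn_mem_FP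
    (comp_mem_FP addFn_mem_FP (fanoutFn_mem_FP (comp_mem_FP addFn_mem_FP (fanoutFn_mem_FP (nthF_mem_FP 2) hF_mem_FP))
      nF_mem_FP)) vF_mem_FP)) nF_mem_FP)
/-- `minF_mem_FP`: membership in `FP` by composition of bricks. [folklore] -/
theorem minF_mem_FP : minF ∈ FP := iteFn_mem_FP ltFn_mem_FP fstF_mem_FP sndF_mem_FP
/-- `mdF_mem_FP`: membership in `FP` by composition of bricks. [folklore] -/
theorem mdF_mem_FP {x : List Bool → List Bool} (hx : x ∈ FP) : mdF x ∈ FP :=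
  comp_mem_FP minF_mem_FP (fanoutFn_mem_FP hx (comp_mem_FP subFn_mem_FP (fanoutFn_mem_FP nF_mem_FP hx)))
/-- `condF_mem_FP`: membership in `FP` by composition of bricks. [folklore] -/
theorem condF_mem_FP : condF ∈ FP := comp_mem_FP ltFn_mem_FP (fanoutFn_mem_FP (mdF_mem_FP a2F_mem_FP) (mdF_mem_FP a1F_mem_FP))
/-- `a'F_mem_FP`: membership in `FP` by composition of bricks. [folklore] -/
theorem a'F_mem_FP : a'F ∈ FP :=
  iteFn_mem_FP condF_mem_FP (comp_mem_FP addFn_mem_FP (fanoutFn_mem_FP (nthF_mem_FP 2) hF_mem_FP))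
    (comp_mem_FP addFn_mem_FP (fanoutFn_mem_FP (nthF_mem_FP 2) (const_mem_FP _)))
/-- `p'F_mem_FP`: membership in `FP` by composition of bricks. [folklore] -/
theorem p'F_mem_FP : p'F ∈ FP := comp_mem_FP addFn_mem_FP (fanoutFn_mem_FP ptF_mem_FP ptF_mem_FP)
/-- `seg'F_mem_FP`: membership in `FP` by composition of bricks. [folklore] -/
theorem seg'F_mem_FP : seg'F ∈ FP := comp_mem_FP tail_mem_FP (comp_mem_FP tail_mem_FP (nthF_mem_FP 1))

/-- `refRound ∈ FP`. [folklore] -/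
theorem refRound_mem_FP : refRound ∈ FP :=
  fanoutFn_mem_FP fstF_mem_FP (fanoutFn_mem_FP seg'F_mem_FP (fanoutFn_mem_FP a'F_mem_FP p'F_mem_FP))

/-- `minF ⟨p, q⟩` on numerals is the minimum. [folklore] -/
theorem minF_boolPair (p q : ℕ) : minF (boolPair (encodeNat p) (encodeNat q)) = encodeNat (min p q) := by
  unfold minF
  by_cases h : p < q
  · rw [iteFn_apply_true (by simp [h]), fstF_boolPair, min_eq_left h.le]
  · rw [iteFn_apply_false (by simp [h]), sndF_boolPair, min_eq_right (le_of_not_gt h)]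

/-- `l.tail.tail = l ⇂ 2`. [folklore] -/
theorem tail_tail_eq_drop_two (l : List Bool) : l.tail.tail = l.drop 2 := by
  rcases l with _ | ⟨a, _ | ⟨b, l⟩⟩ <;> rfl

section refRoundValue

variable (w seg aw Pw : List Bool)

/-- `nF_rrec`: evaluation rule on the refinement record. [folklore] -/
@[simp] theorem nF_rrec : nF (rrec w seg aw Pw) = encodeNat (8 * (bitsToNat Pw % 2 ^ (w.length + 5))) := by simp [nF]
/-- `hF_rrec`: evaluation rule on the refinement record. [folklore] -/
@[simp] theorem hF_rrec : hF (rrec w seg aw Pw) = encodeNat (4 * (bitsToNat Pw % 2 ^ (w.length + 5))) := by simp [hF]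
/-- `a_rrec`: evaluation rule on the refinement record. [folklore] -/
@[simp] theorem a_rrec : nthF 2 (rrec w seg aw Pw) = aw := by simp [rrec]
/-- `seg_rrec`: evaluation rule on the refinement record. [folklore] -/
@[simp] theorem seg_rrec : nthF 1 (rrec w seg aw Pw) = seg := by simp [rrec]
/-- `w_rrec`: evaluation rule on the refinement record. [folklore] -/
@[simp] theorem w_rrec : fstF (rrec w seg aw Pw) = w := by simp [rrec]
/-- `vF_rrec`: evaluation rule on the refinement record. [folklore] -/
@[simp] theorem vF_rrec : vF (rrec w seg aw Pw) = encodeNat (kqv seg * (bitsToNat Pw % 2 ^ (w.length + 5))) := by simp [vF]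
/-- `a1F_rrec`: evaluation rule on the refinement record. [folklore] -/
@[simp] theorem a1F_rrec : a1F (rrec w seg aw Pw) = encodeNat ((bitsToNat aw + 8 * (bitsToNat Pw % 2 ^ (w.length + 5)) - kqv seg * (bitsToNat Pw % 2 ^ (w.length + 5))) % (8 * (bitsToNat Pw % 2 ^ (w.length + 5)))) := by
  simp [a1F]
/-- `a2F_rrec`: evaluation rule on the refinement record. [folklore] -/
@[simp] theorem a2F_rrec :
    a2F (rrec w seg aw Pw) = encodeNat ((bitsToNat aw + 4 * (bitsToNat Pw % 2 ^ (w.length + 5)) + 8 * (bitsToNat Pw % 2 ^ (w.length + 5)) - kqv seg * (bitsToNat Pw % 2 ^ (w.length + 5))) % (8 * (bitsToNat Pw % 2 ^ (w.length + 5)))) := by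
  simp [a2F]
/-- `mdF_rrec`: evaluation rule on the refinement record. [folklore] -/
theorem mdF_rrec {x : List Bool → List Bool} {xv : ℕ} (hx : x (rrec w seg aw Pw) = encodeNat xv) :
    mdF x (rrec w seg aw Pw) = encodeNat (md xv (8 * (bitsToNat Pw % 2 ^ (w.length + 5)))) := by
  simp [mdF, hx, minF_boolPair, md]
/-- `condF_rrec`: evaluation rule on the refinement record. [folklore] -/
@[simp] theorem condF_rrec : condF (rrec w seg aw Pw) =
    [decide (md ((bitsToNat aw + 4 * (bitsToNat Pw % 2 ^ (w.length + 5)) + 8 * (bitsToNat Pw % 2 ^ (w.length + 5)) - kqv seg * (bitsToNat Pw % 2 ^ (w.length + 5))) % (8 * (bitsToNat Pw % 2 ^ (w.length + 5)))) (8 * (bitsToNat Pw % 2 ^ (w.length + 5))) <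
      md ((bitsToNat aw + 8 * (bitsToNat Pw % 2 ^ (w.length + 5)) - kqv seg * (bitsToNat Pw % 2 ^ (w.length + 5))) % (8 * (bitsToNat Pw % 2 ^ (w.length + 5)))) (8 * (bitsToNat Pw % 2 ^ (w.length + 5))))] := by
  simp [condF, mdF_rrec w seg aw Pw (a2F_rrec w seg aw Pw), mdF_rrec w seg aw Pw (a1F_rrec w seg aw Pw)]
/-- `a'F_rrec`: evaluation rule on the refinement record. [folklore] -/
@[simp] theorem a'F_rrec : a'F (rrec w seg aw Pw) = encodeNat (refStep (kqv seg) (bitsToNat aw) (bitsToNat Pw % 2 ^ (w.length + 5))) := by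
  unfold a'F refStep
  split_ifs with h
  · rw [iteFn_apply_true (by rw [condF_rrec, decide_eq_true h])]; simp
  · rw [iteFn_apply_false (by rw [condF_rrec, decide_eq_false h])]; simp
/-- `p'F_rrec`: evaluation rule on the refinement record. [folklore] -/
@[simp] theorem p'F_rrec : p'F (rrec w seg aw Pw) = encodeNat (2 * (bitsToNat Pw % 2 ^ (w.length + 5))) := by simp [p'F, two_mul]
/-- `seg'F_rrec`: evaluation rule on the refinement record. [folklore] -/
@[simp] theorem seg'F_rrec : seg'F (rrec w seg aw Pw) = seg.drop 2 := by simp [seg'F, tail_tail_eq_drop_two]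

/-- **Value of one refinement round.** [cite: Kitaev1995, §3 Lemma 10] -/
theorem refRound_rrec : refRound (rrec w seg aw Pw) =
    rrec w (seg.drop 2) (encodeNat (refStep (kqv seg) (bitsToNat aw) (bitsToNat Pw % 2 ^ (w.length + 5)))) (encodeNat (2 * (bitsToNat Pw % 2 ^ (w.length + 5)))) := by
  simp only [refRound, fanoutFn_apply, w_rrec, seg'F_rrec, a'F_rrec, p'F_rrec]; rfl

end refRoundValue

/-- The first field is kept, on every input. [folklore] -/
theorem fstF_refRound (r : List Bool) : fstF (refRound r) = fstF r := by
  rw [refRound, fanoutFn_apply, fstF_boolPair]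

/-- Numerals below a power of two are short (twin of `Cryptography.length_encodeNat_le_of_lt` of
`ShorClassicalOracle.lean`, whose oracle-machine imports are not wanted here). [folklore] -/
theorem length_encodeNat_le_of_lt {m k : ℕ} (h : m < 2 ^ k) : (encodeNat m).length ≤ k := by
  rw [TM2Pass.length_encodeNat_eq_size]; exact Nat.size_le.2 h

/-- The value of a field is below `2^{length}`. [folklore] -/
theorem bitsToNat_lt_two_pow_of_le {v : List Bool} {k : ℕ} (h : v.length ≤ k) : bitsToNat v < 2 ^ k :=
  lt_of_lt_of_le (bitsToNat_lt v) (Nat.pow_le_pow_right (by norm_num) h)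

/-- `a'F` is at most `a + 4P` with the truncated `P`, on every record. [folklore] -/
theorem bitsToNat_a'F_le (r : List Bool) : bitsToNat (a'F r) ≤ bitsToNat (nthF 2 r) + 4 * bitsToNat (ptF r) := by
  unfold a'F
  obtain ⟨b, hb⟩ := (oneBit_ltFn.comp (fanoutFn (mdF a2F) (mdF a1F))) r
  change condF r = [b] at hb
  cases b
  · rw [iteFn_apply_false hb]; simp
  · rw [iteFn_apply_true hb]; simp [hF]

/-- **Growth of one refinement round**: at most `3 |w| + 40` symbols, on every input (the new
numerals are at most `a + 4P` and `2P` for the truncated `P < 2^{|w|+5}`). [folklore] -/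
theorem length_refRound_le (r : List Bool) :
    (refRound r).length ≤ r.length + 40 * ((boolUnpair r).1.length + 1) := by
  change (refRound r).length ≤ r.length + 40 * ((fstF r).length + 1)
  have h0 := length_fstF_sndF_le r
  have h1 := length_nthF_succ_add_sndPow_succ_le 0 r
  have h2 := length_nthF_succ_add_sndPow_succ_le 1 r
  rw [Nat.zero_add, sndPow_zero] at h1
  -- the new pieces
  have hseg : (seg'F r).length ≤ (nthF 1 r).length := by
    simp only [seg'F, Function.comp_apply, List.length_tail]; omega
  have hpt : bitsToNat (ptF r) < 2 ^ ((fstF r).length + 5) := bitsToNat_ptF_lt r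
  have hp' : (p'F r).length ≤ (fstF r).length + 6 := by
    have e : p'F r = encodeNat (bitsToNat (ptF r) + bitsToNat (ptF r)) := by simp [p'F]
    rw [e]
    refine length_encodeNat_le_of_lt ?_
    rw [pow_succ]; omega
  have ha' : (a'F r).length ≤ (nthF 2 r).length + (fstF r).length + 8 := by
    have ha : bitsToNat (nthF 2 r) < 2 ^ ((nthF 2 r).length + (fstF r).length + 7) :=
      bitsToNat_lt_two_pow_of_le (by omega)
    have hp4 : 4 * 2 ^ ((fstF r).length + 5) ≤ 2 ^ ((nthF 2 r).length + (fstF r).length + 7) :=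
      calc 4 * 2 ^ ((fstF r).length + 5) = 2 ^ ((fstF r).length + 7) := by ring
        _ ≤ 2 ^ ((nthF 2 r).length + (fstF r).length + 7) := Nat.pow_le_pow_right (by norm_num) (by omega)
    have e8 : 2 ^ ((nthF 2 r).length + (fstF r).length + 8) =
        2 ^ ((nthF 2 r).length + (fstF r).length + 7) + 2 ^ ((nthF 2 r).length + (fstF r).length + 7) := by ring
    have hle := bitsToNat_a'F_le r
    have e : a'F r = encodeNat (bitsToNat (a'F r)) := by
      unfold a'F
      obtain ⟨b, hb⟩ := (oneBit_ltFn.comp (fanoutFn (mdF a2F) (mdF a1F))) r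
      change condF r = [b] at hb
      cases b
      · rw [iteFn_apply_false hb]; simp
      · rw [iteFn_apply_true hb]; simp
    rw [e]
    refine length_encodeNat_le_of_lt ?_
    omega
  have haR : 2 * (nthF 2 r).length ≤ (sndPow 1 r).length := by
    norm_num at h2
    omega
  rw [refRound, fanoutFn_apply, fanoutFn_apply, fanoutFn_apply, length_boolPair, length_boolPair, length_boolPair]
  omega

/-- The model of the refinement loop on records: consume the segment two bits at a time, with
the power truncated below `T`. [folklore] -/
def refIter (T : ℕ) : List Bool → ℕ → ℕ → ℕ → ℕ × ℕ
  | _, a, P, 0 => (a, P)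
  | seg, a, P, n + 1 => refIter T (seg.drop 2) (refStep (kqv seg) a (P % T)) (2 * (P % T)) n

/-- The model, zero rounds. [folklore] -/
@[simp] theorem refIter_zero (T : ℕ) (seg : List Bool) (a P : ℕ) : refIter T seg a P 0 = (a, P) := rfl

/-- The model, one more round. [folklore] -/
theorem refIter_succ (T : ℕ) (seg : List Bool) (a P n : ℕ) :
    refIter T seg a P (n + 1) = refIter T (seg.drop 2) (refStep (kqv seg) a (P % T)) (2 * (P % T)) n := rfl

/-- Rounds of the refinement follow the model. [folklore] -/
theorem iterate_refRound (w : List Bool) : ∀ (n : ℕ) (seg : List Bool) (a P : ℕ),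
    refRound^[n] (rrec w seg (encodeNat a) (encodeNat P)) =
      rrec w (seg.drop (2 * n)) (encodeNat (refIter (2 ^ (w.length + 5)) seg a P n).1)
        (encodeNat (refIter (2 ^ (w.length + 5)) seg a P n).2)
  | 0, seg, a, P => by simp
  | n + 1, seg, a, P => by
    rw [Function.iterate_succ_apply, refRound_rrec, bitsToNat_encodeNat, bitsToNat_encodeNat, iterate_refRound w n,
      List.drop_drop, refIter_succ, show 2 + 2 * n = 2 * (n + 1) by ring]

/-- **The model on a genuine reversed segment computes `refineNat`**, from level `ℓ`
downwards, with exact powers of two (no truncation takes place below `2^{ℓ+2} ≤ 2^k`).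
[cite: Kitaev1995, §3 Lemma 10] -/
theorem refIter_revPairs {k ℓ : ℕ} (hk : ℓ + 2 ≤ k) (f : ℕ → List Bool) (κ : ℕ → ℕ)
    (hf : ∀ l, ∃ s c : Bool, f l = [s, c] ∧ kq c s = κ l) :
    ∀ n j, j + n ≤ ℓ →
      refIter (2 ^ k) (revPairs f (ℓ - j)) (refineNat κ (ℓ + 1) j) (2 ^ (j + 1)) n =
        (refineNat κ (ℓ + 1) (j + n), 2 ^ (j + n + 1))
  | 0, j, _ => by simp
  | n + 1, j, hj => by
    obtain ⟨s, c, hsc, hκ⟩ := hf (ℓ - j - 1)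
    have hseg : revPairs f (ℓ - j) = s :: c :: revPairs f (ℓ - (j + 1)) := by
      rw [show ℓ - j = (ℓ - (j + 1)) + 1 by omega, revPairs_succ, show ℓ - (j + 1) = ℓ - j - 1 by omega, hsc]
      rfl
    have hmod : 2 ^ (j + 1) % 2 ^ k = 2 ^ (j + 1) :=
      Nat.mod_eq_of_lt (Nat.pow_lt_pow_right (by norm_num) (by omega))
    rw [show j + (n + 1) = j + 1 + n by omega, refIter_succ, hmod, hseg, kqv_cons_cons, hκ, List.drop_succ_cons,
      List.drop_succ_cons, List.drop_zero, show ℓ - j - 1 = ℓ + 1 - 1 - (j + 1) by omega,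
      ← refineNat_succ_eq_refStep, ← pow_succ', refIter_revPairs hk f κ hf n (j + 1) (by omega)]

/-- A reversed segment of `n` level pairs has `2n` bits. [folklore] -/
theorem length_revPairs {f : ℕ → List Bool} (hf : ∀ l, (f l).length = 2) : ∀ n, (revPairs f n).length = 2 * n
  | 0 => rfl
  | n + 1 => by rw [revPairs_succ, List.length_append, hf, length_revPairs hf n]; ring

/-- **The refinement loop**: `|w|` rounds from `⟨w, ⟨seg ⇂ 2, ⟨kq(front pair), 2⟩⟩⟩`, on an
input `⟨w, seg⟩`. [cite: Kitaev1995, §3 Lemma 10] -/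
def refLoopF : List Bool → List Bool :=
  (fun z => refRound^[(X : Polynomial ℕ).eval (boolUnpair z).1.length] z) ∘
    fanoutFn fstF (fanoutFn (List.tail ∘ List.tail ∘ sndF) (fanoutFn (kqF ∘ sndF) (fun _ => encodeNat 2)))

/-- `refLoopF ∈ FP`. [cite: AroraBarak2009, §1.3 (bounded loops), §1.4.1] -/
theorem refLoopF_mem_FP : refLoopF ∈ FP :=
  comp_mem_FP (iterate_mem_FP_of_growth refRound_mem_FP 40 fstF_refRound length_refRound_le X)
    (fanoutFn_mem_FP fstF_mem_FP (fanoutFn_mem_FP (comp_mem_FP tail_mem_FP (comp_mem_FP tail_mem_FP sndF_mem_FP))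
      (fanoutFn_mem_FP (comp_mem_FP kqF_mem_FP sndF_mem_FP) (const_mem_FP _))))

/-- `refLoopF` on `⟨w, seg⟩` is `|w|` rounds of `refRound`. [folklore] -/
theorem refLoopF_apply (w seg : List Bool) :
    refLoopF (boolPair w seg) = refRound^[w.length] (rrec w (seg.drop 2) (encodeNat (kqv seg)) (encodeNat 2)) := by
  simp only [refLoopF, Function.comp_apply, fanoutFn_apply, fstF_boolPair, sndF_boolPair, boolUnpair_boolPair, eval_X,
    kqF_apply, rrec, tail_tail_eq_drop_two]

/-- The quadrant numerators of the levels of a generator-trial whose control bits start at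
`rest`: `kq (cosine bit) (sine bit)` of level `l`. [cite: Kitaev1995, §3 (before Lemma 9)] -/
def kapOf (B : ℕ) (rest : List Bool) (l : ℕ) : ℕ :=
  kq (tbW B (rest.drop ((B + B) * l))) (tbW B (rest.drop ((B + B) * l + B)))

/-- **Value of the refinement loop on a reversed segment**: the refined numerator
`refineNat (kapOf B rest) (ℓ+1) ℓ` and the power `2^{ℓ+1}`, the segment consumed.
[cite: Kitaev1995, §3 Lemma 10] -/
theorem refLoopF_revPairs (w rest : List Bool) :
    refLoopF (boolPair w (revPairs (lvBits (dlBlockSize w.length) rest) (w.length + 1))) =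
      rrec w [] (encodeNat (refineNat (kapOf (dlBlockSize w.length) rest) (w.length + 1) w.length))
        (encodeNat (2 ^ (w.length + 1))) := by
  generalize dlBlockSize w.length = B
  have hfl : ∀ l, ∃ s c : Bool, lvBits B rest l = [s, c] ∧ kq c s = kapOf B rest l := fun l => ⟨_, _, rfl, rfl⟩
  have h := refIter_revPairs (k := w.length + 5) (ℓ := w.length) (by omega) (lvBits B rest) (kapOf B rest) hfl
    w.length 0 (by omega)
  rw [Nat.zero_add, Nat.zero_add, Nat.sub_zero, pow_one] at h
  have hkq : kqv (revPairs (lvBits B rest) (w.length + 1)) = refineNat (kapOf B rest) (w.length + 1) 0 := by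
    rw [revPairs_succ, refineNat, Nat.add_sub_cancel]; rfl
  have hseg : (revPairs (lvBits B rest) (w.length + 1)).drop 2 = revPairs (lvBits B rest) w.length := by
    rw [revPairs_succ]; rfl
  rw [refLoopF_apply, iterate_refRound, hseg, hkq, h,
    List.drop_eq_nil_of_le (by rw [length_revPairs (fun l => rfl)])]

/-! ### Rounding: the residue of a generator-trial -/

/-- The output record of the refinement of the current generator-trial of a context. [folklore] -/
def refOutF : List Bool → List Bool := refLoopF ∘ fanoutFn fstF segF

/-- `refOutF ∈ FP`. [folklore] -/
theorem refOutF_mem_FP : refOutF ∈ FP := comp_mem_FP refLoopF_mem_FP (fanoutFn_mem_FP fstF_mem_FP segF_mem_FP)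

/-- Value of `refOutF` on a context. [folklore] -/
theorem refOutF_ctx (w : List Bool) (M : ℕ) (rest : List Bool) :
    refOutF (ctx w M rest) =
      rrec w [] (encodeNat (refineNat (kapOf (dlBlockSize w.length) rest) (w.length + 1) w.length))
        (encodeNat (2 ^ (w.length + 1))) := by
  rw [refOutF, Function.comp_apply, fanoutFn_apply, segF_ctx, show fstF (ctx w M rest) = w by simp [ctx],
    refLoopF_revPairs]

/-- **The rounding** `((2 a M + 4 P) / 8 P) mod M` on `⟨M, ⟨w, ⟨seg, ⟨a, P⟩⟩⟩⟩` (`roundMul` of the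
estimate `a / 8P` to the nearest multiple of `1/M`, `roundMul_natCast_div`). [folklore] -/
def rndF : List Bool → List Bool :=
  remFn ∘ fanoutFn (divFn ∘ fanoutFn
    (addFn ∘ fanoutFn (prodFn ∘ fanoutFn (mulCF 2 (nthF 3)) fstF) (mulCF 4 (sndPow 3))) (mulCF 8 (sndPow 3))) fstF

/-- `rndF ∈ FP`. [folklore] -/
theorem roundF_mem_FP : rndF ∈ FP :=
  comp_mem_FP remFn_mem_FP (fanoutFn_mem_FP (comp_mem_FP divFn_mem_FP (fanoutFn_mem_FP
    (comp_mem_FP addFn_mem_FP (fanoutFn_mem_FP (comp_mem_FP prodFn_mem_FP (fanoutFn_mem_FP (mulCF_mem_FP 2 (nthF_mem_FP 3))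
      fstF_mem_FP)) (mulCF_mem_FP 4 (sndPow_mem_FP 3)))) (mulCF_mem_FP 8 (sndPow_mem_FP 3)))) fstF_mem_FP)

/-- Value of `rndF`. [folklore] -/
theorem roundF_apply (M a P : ℕ) (w seg : List Bool) :
    rndF (boolPair (encodeNat M) (rrec w seg (encodeNat a) (encodeNat P))) =
      encodeNat ((2 * a * M + 4 * P) / (8 * P) % M) := by
  simp [rndF, rrec]

/-- **The residue of the current generator-trial** of a context `⟨w, ⟨M, rest⟩⟩`:
`((2 a M + 2^{ℓ+3}) / 2^{ℓ+4}) mod M` for the refined numerator `a`. [folklore] -/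
def resF : List Bool → List Bool := rndF ∘ fanoutFn (nthF 1) refOutF

/-- `resF ∈ FP`. [folklore] -/
theorem resF_mem_FP : resF ∈ FP := comp_mem_FP roundF_mem_FP (fanoutFn_mem_FP (nthF_mem_FP 1) refOutF_mem_FP)

/-- Value of `resF` on a context. [folklore] -/
theorem resF_ctx (w : List Bool) (M : ℕ) (rest : List Bool) :
    resF (ctx w M rest) =
      encodeNat ((2 * refineNat (kapOf (dlBlockSize w.length) rest) (w.length + 1) w.length * M + 2 ^ (w.length + 3)) /
        2 ^ (w.length + 4) % M) := by
  rw [resF, Function.comp_apply, fanoutFn_apply, refOutF_ctx, show nthF 1 (ctx w M rest) = encodeNat M by simp [ctx],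
    roundF_apply, show 4 * 2 ^ (w.length + 1) = 2 ^ (w.length + 3) by ring,
    show 8 * 2 ^ (w.length + 1) = 2 ^ (w.length + 4) by ring]

/-- The offsets of the layout are those of the sequential reading: cosine window of level `l`
of generator-trial `u`. [folklore] -/
theorem dlOff_false (ℓ u l : ℕ) : dlOff ℓ u l false = genLen ℓ * u + (dlBlockSize ℓ + dlBlockSize ℓ) * l := by
  simp only [dlOff, genLen, dlNumLevels, Bool.toNat_false]; ring

/-- The offsets of the layout are those of the sequential reading: sine window. [folklore] -/
theorem dlOff_true (ℓ u l : ℕ) :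
    dlOff ℓ u l true = genLen ℓ * u + ((dlBlockSize ℓ + dlBlockSize ℓ) * l + dlBlockSize ℓ) := by
  simp only [dlOff, genLen, dlNumLevels, Bool.toNat_true]; ring

/-- **The level numerators read sequentially are those of the layout** (`dlKap`), for the levels
`l ≤ ℓ`. [folklore] -/
theorem kapOf_eq_dlKap (ℓ : ℕ) (y' : List Bool) (u l : ℕ) (hl : l ≤ ℓ) :
    kapOf (dlBlockSize ℓ) (y'.drop (genLen ℓ * u)) l = dlKap ℓ y' u l := by
  rw [dlKap, if_pos (show l < dlNumLevels ℓ from Nat.lt_succ_of_le hl), kapOf, List.drop_drop, List.drop_drop,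
    dlTb, dlTb, dlOff_false, dlOff_true, tbW, tbW]

/-- **`resF` computes `dlRes`** on the context of generator-trial `u`. [folklore] -/
theorem resF_ctx_eq_dlRes (w y' : List Bool) (u : ℕ) :
    resF (ctx w (dlMod w) (y'.drop (genLen w.length * u))) = encodeNat (dlRes w y' u) := by
  rw [resF_ctx, dlRes, dlRef, show dlNumLevels w.length = w.length + 1 from rfl,
    refineNat_congr (κ' := dlKap w.length y' u) fun l hl => kapOf_eq_dlKap _ _ _ _ (by omega)]

/-! ### Extended Euclid modulo `M` -/

/-- The record of the Euclid loop: `⟨x, ⟨k, ⟨r, ⟨s, ⟨t, ⟨s', ⟨t', ε⟩⟩⟩⟩⟩⟩⟩` with the numerals of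
a state `σ` (`x = ⟨w, M⟩` is the clock and carries the modulus). [folklore] -/
def xrec (x : List Bool) (σ : XgSt) : List Bool :=
  boolPair x (boolPair (encodeNat σ.k) (boolPair (encodeNat σ.r) (boolPair (encodeNat σ.s) (boolPair (encodeNat σ.t)
    (boolPair (encodeNat σ.s') (boolPair (encodeNat σ.t') []))))))

/-- The modulus read off the record: `⟦snd x⟧`. [folklore] -/
def xM : List Bool → List Bool := sndF ∘ fstF
/-- The quotient `r / k`. [folklore] -/
def xq : List Bool → List Bool := divFn ∘ fanoutFn (nthF 2) (nthF 1)
/-- The Bézout update `(c' + M - (q c mod M)) mod M` of the fields `c = nthF i`, `c' = nthF i'`.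
[cite: CLRS2009, §31.2 (EXTENDED-EUCLID)] -/
def xupd (i i' : ℕ) : List Bool → List Bool :=
  remFn ∘ fanoutFn (subFn ∘ fanoutFn (addFn ∘ fanoutFn (nthF i') xM)
    (remFn ∘ fanoutFn (prodFn ∘ fanoutFn xq (nthF i)) xM)) xM
/-- The Euclid step on the record (divisor `k ≠ 0`). [cite: CLRS2009, §31.2 (EXTENDED-EUCLID)] -/
def xstepF : List Bool → List Bool :=
  fanoutFn fstF (fanoutFn (remFn ∘ fanoutFn (nthF 2) (nthF 1)) (fanoutFn (nthF 1) (fanoutFn (xupd 3 5)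
    (fanoutFn (xupd 4 6) (fanoutFn (nthF 3) (fanoutFn (nthF 4) (fun _ => [])))))))
/-- **One round of extended Euclid modulo `M`**: identity once the divisor field is empty
(`k = 0`). [cite: CLRS2009, §31.2 (EXTENDED-EUCLID)] -/
def xgRound : List Bool → List Bool := iteFn (isNilFn ∘ nthF 1) idF xstepF

/-- `xM_mem_FP`: membership in `FP` by composition of bricks. [folklore] -/
theorem xM_mem_FP : xM ∈ FP := comp_mem_FP sndF_mem_FP fstF_mem_FP
/-- `xq_mem_FP`: membership in `FP` by composition of bricks. [folklore] -/
theorem xq_mem_FP : xq ∈ FP := comp_mem_FP divFn_mem_FP (fanoutFn_mem_FP (nthF_mem_FP 2) (nthF_mem_FP 1))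
/-- `xupd_mem_FP`: membership in `FP` by composition of bricks. [folklore] -/
theorem xupd_mem_FP (i i' : ℕ) : xupd i i' ∈ FP :=
  comp_mem_FP remFn_mem_FP (fanoutFn_mem_FP (comp_mem_FP subFn_mem_FP (fanoutFn_mem_FP
    (comp_mem_FP addFn_mem_FP (fanoutFn_mem_FP (nthF_mem_FP i') xM_mem_FP))
    (comp_mem_FP remFn_mem_FP (fanoutFn_mem_FP (comp_mem_FP prodFn_mem_FP (fanoutFn_mem_FP xq_mem_FP (nthF_mem_FP i)))
      xM_mem_FP)))) xM_mem_FP)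
/-- `xstepF_mem_FP`: membership in `FP` by composition of bricks. [folklore] -/
theorem xstepF_mem_FP : xstepF ∈ FP :=
  fanoutFn_mem_FP fstF_mem_FP (fanoutFn_mem_FP (comp_mem_FP remFn_mem_FP (fanoutFn_mem_FP (nthF_mem_FP 2) (nthF_mem_FP 1)))
    (fanoutFn_mem_FP (nthF_mem_FP 1) (fanoutFn_mem_FP (xupd_mem_FP 3 5) (fanoutFn_mem_FP (xupd_mem_FP 4 6)
      (fanoutFn_mem_FP (nthF_mem_FP 3) (fanoutFn_mem_FP (nthF_mem_FP 4) (const_mem_FP _)))))))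

/-- `xgRound ∈ FP`. [folklore] -/
theorem xgRound_mem_FP : xgRound ∈ FP :=
  iteFn_mem_FP (comp_mem_FP isNilFn_mem_FP (nthF_mem_FP 1)) idF_mem_FP xstepF_mem_FP

section xrecValue

variable (x : List Bool) (σ : XgSt)

/-- `xrec_fst`: evaluation rule on the Euclid record. [folklore] -/
@[simp] theorem xrec_fst : fstF (xrec x σ) = x := by simp [xrec]
/-- `xrec_k`: evaluation rule on the Euclid record. [folklore] -/
@[simp] theorem xrec_k : nthF 1 (xrec x σ) = encodeNat σ.k := by simp [xrec]
/-- `xrec_r`: evaluation rule on the Euclid record. [folklore] -/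
@[simp] theorem xrec_r : nthF 2 (xrec x σ) = encodeNat σ.r := by simp [xrec]
/-- `xrec_s`: evaluation rule on the Euclid record. [folklore] -/
@[simp] theorem xrec_s : nthF 3 (xrec x σ) = encodeNat σ.s := by simp [xrec]
/-- `xrec_t`: evaluation rule on the Euclid record. [folklore] -/
@[simp] theorem xrec_t : nthF 4 (xrec x σ) = encodeNat σ.t := by simp [xrec]
/-- `xrec_s'`: evaluation rule on the Euclid record. [folklore] -/
@[simp] theorem xrec_s' : nthF 5 (xrec x σ) = encodeNat σ.s' := by simp [xrec]
/-- `xrec_t'`: evaluation rule on the Euclid record. [folklore] -/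
@[simp] theorem xrec_t' : nthF 6 (xrec x σ) = encodeNat σ.t' := by simp [xrec]
/-- `xM_xrec`: evaluation rule on the Euclid record. [folklore] -/
@[simp] theorem xM_xrec : xM (xrec x σ) = sndF x := by simp [xM]
/-- `xq_xrec`: evaluation rule on the Euclid record. [folklore] -/
@[simp] theorem xq_xrec : xq (xrec x σ) = encodeNat (σ.r / σ.k) := by simp [xq]
/-- `xupd_xrec`: evaluation rule on the Euclid record. [folklore] -/
theorem xupd_xrec (i i' : ℕ) {c c' : ℕ} (hc : nthF i (xrec x σ) = encodeNat c) (hc' : nthF i' (xrec x σ) = encodeNat c') :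
    xupd i i' (xrec x σ) =
      encodeNat ((c' + bitsToNat (sndF x) - σ.r / σ.k * c % bitsToNat (sndF x)) % bitsToNat (sndF x)) := by
  simp [xupd, hc, hc']

/-- **Value of one Euclid round**: `xgStep` on the state. [cite: CLRS2009, §31.2 (EXTENDED-EUCLID)] -/
theorem xgRound_xrec : xgRound (xrec x σ) = xrec x (xgStep (bitsToNat (sndF x)) σ) := by
  unfold xgRound xgStep
  by_cases hk : σ.k = 0
  · rw [iteFn_apply_true (by simp [isNilFn, hk, encodeNat_eq_nil_iff]), if_pos hk]; rfl
  · rw [iteFn_apply_false (by simp [isNilFn, hk, encodeNat_eq_nil_iff]), if_neg hk]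
    simp only [xstepF, fanoutFn_apply, xrec_fst, Function.comp_apply, xrec_r, xrec_k, remFn_boolPair, bitsToNat_encodeNat,
      xupd_xrec x σ 3 5 (xrec_s x σ) (xrec_s' x σ), xupd_xrec x σ 4 6 (xrec_t x σ) (xrec_t' x σ), xrec_s, xrec_t]
    rfl

end xrecValue

/-- Rounds of Euclid follow `xgStep`. [folklore] -/
theorem iterate_xgRound (x : List Bool) : ∀ (n : ℕ) (σ : XgSt),
    xgRound^[n] (xrec x σ) = xrec x ((xgStep (bitsToNat (sndF x)))^[n] σ)
  | 0, σ => rfl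
  | n + 1, σ => by rw [Function.iterate_succ_apply, xgRound_xrec, iterate_xgRound x n, ← Function.iterate_succ_apply]

/-- The first field is kept, on every input. [folklore] -/
theorem fstF_xgRound (z : List Bool) : fstF (xgRound z) = fstF z := by
  rw [xgRound, iteFn_of_oneBit (oneBit_isNilFn.comp _)]
  split_ifs
  · rfl
  · rw [xstepF, fanoutFn_apply, fstF_boolPair]

/-- The Bézout update is a short numeral: below the modulus, or below the old coefficient when
the modulus is `0`. [folklore] -/
theorem length_xupd_le (i i' : ℕ) (z : List Bool) : (xupd i i' z).length ≤ (nthF i' z).length + (fstF z).length := by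
  have hM : (xM z).length ≤ (fstF z).length := by
    have := length_fstF_sndF_le (fstF z)
    simp only [xM, Function.comp_apply]; omega
  have e : xupd i i' z = encodeNat ((bitsToNat (nthF i' z) + bitsToNat (xM z) - bitsToNat (xq z) * bitsToNat (nthF i z) %
      bitsToNat (xM z)) % bitsToNat (xM z)) := by simp [xupd]
  rw [e]
  rcases Nat.eq_zero_or_pos (bitsToNat (xM z)) with h0 | hpos
  · rw [h0, Nat.mod_zero, Nat.mod_zero, Nat.add_zero]
    exact (length_encodeNat_mono (Nat.sub_le _ _)).trans ((length_encodeNat_bitsToNat_le _).trans (Nat.le_add_right _ _))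
  · refine (length_encodeNat_mono (Nat.mod_lt _ hpos).le).trans ?_
    exact (length_encodeNat_bitsToNat_le _).trans (hM.trans (Nat.le_add_left _ _))

/-- **Growth of one Euclid round**: at most `4 |x| + 16` symbols, on every input. [folklore] -/
theorem length_xgRound_le (z : List Bool) : (xgRound z).length ≤ z.length + 16 * ((boolUnpair z).1.length + 1) := by
  change (xgRound z).length ≤ z.length + 16 * ((fstF z).length + 1)
  rw [xgRound, iteFn_of_oneBit (oneBit_isNilFn.comp _)]
  split_ifs
  · simp only [idF]; omega
  · have h0 := length_fstF_sndF_le z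
    have h1 := length_nthF_succ_add_sndPow_succ_le 0 z
    have h2 := length_nthF_succ_add_sndPow_succ_le 1 z
    have h3 := length_nthF_succ_add_sndPow_succ_le 2 z
    have h4 := length_nthF_succ_add_sndPow_succ_le 3 z
    have h5 := length_nthF_succ_add_sndPow_succ_le 4 z
    have h6 := length_nthF_succ_add_sndPow_succ_le 5 z
    norm_num at h1 h2 h3 h4 h5 h6
    have hk : ((remFn ∘ fanoutFn (nthF 2) (nthF 1)) z).length ≤ (nthF 2 z).length := by
      have e : (remFn ∘ fanoutFn (nthF 2) (nthF 1)) z = encodeNat (bitsToNat (nthF 2 z) % bitsToNat (nthF 1 z)) := by simp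
      rw [e]; exact (length_encodeNat_mono (Nat.mod_le _ _)).trans (length_encodeNat_bitsToNat_le _)
    have hs := length_xupd_le 3 5 z
    have ht := length_xupd_le 4 6 z
    simp only [xstepF, fanoutFn_apply, length_boolPair, List.length_nil]
    omega

/-- **The Euclid loop**: `|x|` rounds of `xgRound`. [cite: CLRS2009, §31.2 (EXTENDED-EUCLID)] -/
def xgLoopF : List Bool → List Bool := fun z => xgRound^[(X : Polynomial ℕ).eval (boolUnpair z).1.length] z

/-- `xgLoopF ∈ FP`. [cite: AroraBarak2009, §1.3 (bounded loops), §1.4.1] -/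
theorem xgLoopF_mem_FP : xgLoopF ∈ FP := iterate_mem_FP_of_growth xgRound_mem_FP 16 fstF_xgRound length_xgRound_le X

/-- Value of the Euclid loop on a record. [folklore] -/
theorem xgLoopF_xrec (x : List Bool) (σ : XgSt) :
    xgLoopF (xrec x σ) = xrec x ((xgStep (bitsToNat (sndF x)))^[x.length] σ) := by
  rw [xgLoopF, ← iterate_xgRound, eval_X]
  congr 2
  simp [xrec]

/-! ### One step of the congruence solver -/

/-- `1 mod M` from the solver input `⟨x, …⟩`, `x = ⟨w, M⟩`. [folklore] -/
def oneModF : List Bool → List Bool := remFn ∘ fanoutFn (fun _ => [true]) xM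

/-- The initial Euclid record `xrec x (xgInit M g s)` from the solver input
`⟨x, ⟨s, ⟨c, ⟨g, e⟩⟩⟩⟩`. [folklore] -/
def xgInitF : List Bool → List Bool :=
  fanoutFn fstF (fanoutFn (nthF 3) (fanoutFn (nthF 1) (fanoutFn oneModF (fanoutFn (fun _ => [])
    (fanoutFn (fun _ => []) (fanoutFn oneModF (fun _ => [])))))))

/-- The solver input record `⟨x, ⟨s, ⟨c, ⟨g, e⟩⟩⟩⟩`. [folklore] -/
def srec (x : List Bool) (s c g e : ℕ) : List Bool :=
  boolPair x (boolPair (encodeNat s) (boolPair (encodeNat c) (boolPair (encodeNat g) (encodeNat e))))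

/-- Value of `xgInitF`. [folklore] -/
theorem xgInitF_srec (x : List Bool) (s c g e : ℕ) :
    xgInitF (srec x s c g e) = xrec x (xgInit (bitsToNat (sndF x)) g s) := by
  simp [xgInitF, srec, xrec, xgInit, oneModF, xM, show encodeNat 0 = [] from rfl]

/-- `oneModF_mem_FP`: membership in `FP` by composition of bricks. [folklore] -/
theorem oneModF_mem_FP : oneModF ∈ FP := comp_mem_FP remFn_mem_FP (fanoutFn_mem_FP (const_mem_FP _) xM_mem_FP)
/-- `xgInitF_mem_FP`: membership in `FP` by composition of bricks. [folklore] -/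
theorem xgInitF_mem_FP : xgInitF ∈ FP :=
  fanoutFn_mem_FP fstF_mem_FP (fanoutFn_mem_FP (nthF_mem_FP 3) (fanoutFn_mem_FP (nthF_mem_FP 1) (fanoutFn_mem_FP oneModF_mem_FP
    (fanoutFn_mem_FP (const_mem_FP _) (fanoutFn_mem_FP (const_mem_FP _) (fanoutFn_mem_FP oneModF_mem_FP (const_mem_FP _)))))))

/-- The read-out of the solver step on `⟨input, final Euclid record⟩`: `⟨gcd, (e a + c b) mod M⟩`.
[folklore] -/
def solveOutF : List Bool → List Bool :=
  fanoutFn (nthF 2 ∘ sndF) (remFn ∘ fanoutFn (addFn ∘ fanoutFn (prodFn ∘ fanoutFn (sndPow 3 ∘ fstF) (nthF 5 ∘ sndF))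
    (prodFn ∘ fanoutFn (nthF 2 ∘ fstF) (nthF 6 ∘ sndF))) (xM ∘ fstF))

/-- `solveOutF_mem_FP`: membership in `FP` by composition of bricks. [folklore] -/
theorem solveOutF_mem_FP : solveOutF ∈ FP :=
  fanoutFn_mem_FP (comp_mem_FP (nthF_mem_FP 2) sndF_mem_FP) (comp_mem_FP remFn_mem_FP (fanoutFn_mem_FP
    (comp_mem_FP addFn_mem_FP (fanoutFn_mem_FP
      (comp_mem_FP prodFn_mem_FP (fanoutFn_mem_FP (comp_mem_FP (sndPow_mem_FP 3) fstF_mem_FP) (comp_mem_FP (nthF_mem_FP 5) sndF_mem_FP)))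
      (comp_mem_FP prodFn_mem_FP (fanoutFn_mem_FP (comp_mem_FP (nthF_mem_FP 2) fstF_mem_FP) (comp_mem_FP (nthF_mem_FP 6) sndF_mem_FP)))))
    (comp_mem_FP xM_mem_FP fstF_mem_FP)))

/-- **One step of the congruence solver** (`solveStepM M |x|`) on `⟨x, ⟨s, ⟨c, ⟨g, e⟩⟩⟩⟩`.
[cite: Kitaev1995, §1 p.5 (discrete logarithm from the stabilizer)] -/
def solveStepF : List Bool → List Bool := solveOutF ∘ fanoutFn idF (xgLoopF ∘ xgInitF)

/-- `solveStepF ∈ FP`. [folklore] -/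
theorem solveStepF_mem_FP : solveStepF ∈ FP :=
  comp_mem_FP solveOutF_mem_FP (fanoutFn_mem_FP idF_mem_FP (comp_mem_FP xgLoopF_mem_FP xgInitF_mem_FP))

/-- **Value of the solver step.** [folklore] -/
theorem solveStepF_srec (x : List Bool) (s c g e : ℕ) :
    solveStepF (srec x s c g e) =
      boolPair (encodeNat (solveStepM (bitsToNat (sndF x)) x.length (g, e) (s, c)).1)
        (encodeNat (solveStepM (bitsToNat (sndF x)) x.length (g, e) (s, c)).2) := by
  rw [solveStepF, Function.comp_apply, fanoutFn_apply, Function.comp_apply, xgInitF_srec, xgLoopF_xrec, solveStepM]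
  simp [solveOutF, srec, idF, xM]

/-! ### The fold over the four pairs and the post-processor -/

/-- The clock-and-modulus field `x = ⟨w, M⟩` of a context. [folklore] -/
def xOfCtx : List Bool → List Bool := fanoutFn fstF (nthF 1)

/-- **The fold of the congruence solver** over the residue pairs of the generator-trials
`(2t, 2t+1)`, `t < n`, from `(M, 0)`, as a function of the initial context. [folklore] -/
def foldF : ℕ → List Bool → List Bool
  | 0 => fanoutFn (nthF 1) (fun _ => [])
  | t + 1 => solveStepF ∘ fanoutFn xOfCtx (fanoutFn (resF ∘ (nextF^[2 * t])) (fanoutFn (resF ∘ (nextF^[2 * t + 1])) (foldF t)))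

/-- `foldF t ∈ FP`. [folklore] -/
theorem foldF_mem_FP : ∀ t, foldF t ∈ FP
  | 0 => fanoutFn_mem_FP (nthF_mem_FP 1) (const_mem_FP _)
  | t + 1 => comp_mem_FP solveStepF_mem_FP (fanoutFn_mem_FP (fanoutFn_mem_FP fstF_mem_FP (nthF_mem_FP 1))
      (fanoutFn_mem_FP (comp_mem_FP resF_mem_FP (nextF_iterate_mem_FP _))
        (fanoutFn_mem_FP (comp_mem_FP resF_mem_FP (nextF_iterate_mem_FP _)) (foldF_mem_FP t))))

/-- The number of Euclid rounds the solver runs on the context of `w`: `|⟨w, M⟩|`. [folklore] -/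
def nRounds (w : List Bool) : ℕ := (boolPair w (encodeNat (dlMod w))).length

/-- Enough Euclid rounds: `2 · size M ≤ nRounds w`. [folklore] -/
theorem two_mul_size_le_nRounds (w : List Bool) : 2 * Nat.size (dlMod w) ≤ nRounds w := by
  rw [nRounds, length_boolPair]
  have := size_dlMod_le w
  omega

/-- **Value of the fold** on the initial context of `⟨w, y'⟩`. [folklore] -/
theorem foldF_ctx (w y' : List Bool) : ∀ t,
    foldF t (ctx w (dlMod w) y') =
      boolPair (encodeNat (((List.range t).map fun t => (dlRes w y' (2 * t), dlRes w y' (2 * t + 1))).foldl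
          (solveStepM (dlMod w) (nRounds w)) (dlMod w, 0)).1)
        (encodeNat (((List.range t).map fun t => (dlRes w y' (2 * t), dlRes w y' (2 * t + 1))).foldl
          (solveStepM (dlMod w) (nRounds w)) (dlMod w, 0)).2)
  | 0 => by simp [foldF, ctx, show encodeNat 0 = [] from rfl]
  | t + 1 => by
    rw [foldF, Function.comp_apply, fanoutFn_apply, fanoutFn_apply, fanoutFn_apply, foldF_ctx w y' t, Function.comp_apply,
      Function.comp_apply, nextF_iterate_ctx, nextF_iterate_ctx, resF_ctx_eq_dlRes, resF_ctx_eq_dlRes,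
      show xOfCtx (ctx w (dlMod w) y') = boolPair w (encodeNat (dlMod w)) by simp [xOfCtx, ctx], ← srec, solveStepF_srec,
      sndF_boolPair, bitsToNat_encodeNat, List.range_succ, List.map_append, List.foldl_append, List.map_singleton,
      List.foldl_cons, List.foldl_nil]
    rfl

/-- **The discrete-logarithm post-processor as a brick**: `[]` when the modulus numeral is
empty (`M = 0`), else the numeral of the solved congruence system. [cite: Kitaev1995, §1 p.5, §3 Lemma 10 and §4 p.15] -/
def dlogPostF : List Bool → List Bool := iteFn (isNilFn ∘ nthF 1 ∘ ctx0F) (fun _ => []) (sndF ∘ foldF numTrials ∘ ctx0F)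

/-- **`dlogPostF ∈ FP`.** [cite: AroraBarak2009, §1.3 (closure of polynomial time under composition and bounded loops)] -/
theorem dlogPostF_mem_FP : dlogPostF ∈ FP :=
  iteFn_mem_FP (comp_mem_FP isNilFn_mem_FP (comp_mem_FP (nthF_mem_FP 1) ctx0F_mem_FP)) (const_mem_FP _)
    (comp_mem_FP sndF_mem_FP (comp_mem_FP (foldF_mem_FP _) ctx0F_mem_FP))

/-- **The brick is the post-processor** (`dlogPost_eq`, with the Euclid round count `nRounds w` in
place of `2ℓ + 2`: both are at least `2 · size M`, so both folds give `solveCongr`,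
`solveCongr_eq_foldl_solveStepM`). [cite: Kitaev1995, §1 p.5, §3 Lemma 10 and §4 p.15] -/
theorem dlogPostF_eq_dlogPost : dlogPostF = dlogPost := by
  funext z
  rw [dlogPost_eq, dlogPostF]
  have hctx := ctx0F_apply z
  set w := (boolUnpair z).1 with hw
  set y' := (boolUnpair z).2.drop (boolUnpair z).1.length with hy'
  have hM : (nthF 1 ∘ ctx0F) z = encodeNat (dlMod w) := by simp [hctx, ctx]
  by_cases h0 : dlMod w = 0
  · rw [iteFn_apply_true (by rw [Function.comp_apply, hM, h0]; rfl), if_pos h0]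
  · have hM0 : 0 < dlMod w := Nat.pos_of_ne_zero h0
    rw [iteFn_apply_false (by rw [Function.comp_apply, hM]; simp [isNilFn, encodeNat_eq_nil_iff, h0]), if_neg h0,
      Function.comp_apply, Function.comp_apply, hctx, foldF_ctx, sndF_boolPair,
      ← solveCongr_eq_foldl_solveStepM hM0 (two_mul_size_le_nRounds w),
      solveCongr_eq_foldl_solveStepM hM0 (n := 2 * w.length + 2) (by have := size_dlMod_le w; omega)]
    rfl

/-- **Discharge of the programming fact `dlogPost_mem_FP`** (`ShorDiscreteLogQuantum.lean`): the
classical post-processor of Kitaev's discrete-logarithm experiment — block counts, quadrant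
centres, `ℓ` halving steps over dyadic rationals for each of the eight generator-trials, rounding
to the nearest multiple of `1/(p-1)`, and four extended-Euclid steps modulo `p - 1` — is computable
in polynomial time (Kitaev 1995, §3 Lemma 10: "by a polynomial algorithm"; §4 p. 15: "processed
in a classical way"). [cite: Kitaev1995, §3 Lemma 10 and §4 p.15] -/
theorem _root_.Literature.Computability.Cryptography.dlogPost_mem_FP_holds : dlogPost_mem_FP := by
  rw [dlogPost_mem_FP, ← dlogPostF_eq_dlogPost]
  exact dlogPostF_mem_FP

end DLogPostFP

end Kitaev1995

end Literature.Computability.Cryptography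

end
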